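import Summits.AnomalousDissipation.AnomalousDissipation.Statement
import Literature.Analysis.FluidPDE.TorusClassicalLerayHopfProofs
import Literature.Analysis.FluidPDE.GalerkinEnergyBalanceLongTime
import HarnessLib

/-!
# Reduction of the zeroth law to families of classical solutions (solo-informed)

`AnomalousDissipation` (= `Literature.Turb.ZerothLaw`) asks for ONE smooth steady force `f` on
`T³` and a vanishing-viscosity sequence of global Leray–Hopf solutions with uniformly bounded
mean energy and mean dissipation bounded away from zero.  The initial data are free (they may
depend on the index), and a Leray–Hopf solution need not be stable or attracting.  Hence:

* `anomalousDissipation_of_classicalFamily` — it suffices to produce GLOBAL CLASSICAL solutions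
  `(u_j, p_j)` of `NS_{ν_j} + f` on `ℝ × T³` with `sup_j ⟨∫‖u_j‖²⟩⁺ < ∞` and
  `inf_j ⟨ν_j ‖∇u_j‖₂²⟩⁺ > 0` (derivative-based `Torus.gradNormSq`); the Leray–Hopf property is
  the discharged fact `Torus.IsClassicalNSSolutionOn.isGlobalLerayHopf`
  (Robinson–Rodrigo–Sadowski 2016, Thm. 6.5) and `‖∇·‖₂²` is identified spectrally by
  `Torus.gradNormSq_eq_toReal_eGradNormSq_holds` (Parseval).
* `anomalousDissipation_of_steadyFamily` — in particular it suffices to produce smooth STEADY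
  states `U_j` of `NS_{ν_j} + f` (any, however unstable) with `∫‖U_j‖² ≤ E` and
  `ν_j ‖∇U_j‖₂² ≥ ε > 0`: the summit is implied by the existence, for one fixed force, of a
  vanishing-viscosity branch of steady states whose dissipation does not vanish.  For a steady
  state the dissipation equals the injected power `∫⟪f, U_j⟫`, so equivalently: steady states that
  stay correlated with the force at bounded energy.

These are reductions only (modus ponens to the summit); they convert the zeroth law into a
statement about the `ν → 0` behaviour of the set of bounded classical (in particular steady or
time-periodic) solutions of the forced system — a continuation / bifurcation problem.

References: J. C. Robinson, J. L. Rodrigo, W. Sadowski, *The Three-Dimensional Navier–Stokes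
Equations*, CUP 2016, Thm. 6.5 [RobinsonRodrigoSadowski2016]; C. Doering, C. Foias, *Energy
dissipation in body-forced turbulence*, JFM 467 (2002) §2 [DoeringFoias2002]; E. Bruè,
C. De Lellis, *Anomalous dissipation for the forced 3D Navier–Stokes equations*, CMP 400 (2023),
Q. 2.1–2.2 [BrueDeLellis2023].
-/

noncomputable section

open MeasureTheory Filter Topology Set
open scoped ENNReal NNReal

namespace Summit.AnomalousDissipation.AnomalousDissipation.Theorems

open Literature.Analysis.FunctionSpaces Literature.Analysis.FluidPDE

/-- The physical flat unit torus `T³ = (ℝ/ℤ)³` (local notation). -/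
local notation "𝕋³" => UnitAddTorus (Fin 3)
/-- Velocity values on `T³` (local notation). -/
local notation "E³" => EuclideanSpace ℝ (Fin 3)

/-- For a global classical solution the spectral mean dissipation of the zeroth-law vocabulary is
the limsup-mean of the derivative-based `ν ‖∇u(t)‖₂²` (Parseval on each smooth slice,
`Torus.gradNormSq_eq_toReal_eGradNormSq_holds`). [folklore] -/
theorem meanDissipation_eq_of_classical {ν : ℝ} {f u : ℝ → 𝕋³ → E³} {p : ℝ → 𝕋³ → ℝ}
    (h : Torus.IsClassicalNSSolutionOn univ ν f u p) :
    meanDissipation ν u = longTimeAvgSup (fun t => ν * Torus.gradNormSq (u t)) := by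
  unfold meanDissipation
  congr 1
  funext t
  rw [Torus.gradNormSq_eq_toReal_eGradNormSq_holds (h.smooth_velocity.isSmooth_slice (mem_univ t))]

/-- **Reduction 1 (classical families).**  One smooth, divergence-free, mean-zero steady force
`f`; viscosities `ν_j > 0`, `ν_j → 0`; global classical solutions `(u_j, p_j)` of the forced
Navier–Stokes system on `ℝ × T³`; uniformly bounded limsup-mean energy; limsup-mean
(derivative-based) dissipation `⟨ν_j ‖∇u_j(t)‖₂²⟩⁺ ≥ ε > 0`.  Then the zeroth law holds, with
data `u_j(0)`: global classical solutions are global Leray–Hopf solutions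
(Robinson–Rodrigo–Sadowski 2016, Thm. 6.5; `Torus.IsClassicalNSSolutionOn.isGlobalLerayHopf`).
[cite: RobinsonRodrigoSadowski2016, Thm. 6.5] -/
theorem anomalousDissipation_of_classicalFamily {f : 𝕋³ → E³} (hf : Torus.IsSmooth f)
    (hdiv : Torus.IsDivFree f) (hmean : Torus.HasZeroMean f)
    {ν : ℕ → ℝ} {u : ℕ → ℝ → 𝕋³ → E³} {p : ℕ → ℝ → 𝕋³ → ℝ}
    (hν : ∀ j, 0 < ν j) (hν0 : Tendsto ν atTop (𝓝 0))
    (hsol : ∀ j, Torus.IsClassicalNSSolutionOn univ (ν j) (fun _ => f) (u j) (p j))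
    (hE : ∃ E : ℝ, ∀ j, meanEnergy (u j) ≤ E)
    (hε : ∃ ε : ℝ, 0 < ε ∧ ∀ j, ε ≤ longTimeAvgSup (fun t => ν j * Torus.gradNormSq (u j t))) :
    _root_.AnomalousDissipation := by
  obtain ⟨ε, hε, hεle⟩ := hε
  refine ⟨f, hf, hdiv, hmean, ν, fun j => u j 0, u, hν, hν0, fun j => (hsol j).isGlobalLerayHopf,
    hE, ε, hε, fun j => ?_⟩
  rw [meanDissipation_eq_of_classical (hsol j)]
  exact hεle j

/-- **Reduction 2 (steady families).**  One smooth, divergence-free, mean-zero steady force `f`;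
viscosities `ν_j > 0`, `ν_j → 0`; smooth steady states `(U_j, P_j)` of the forced Navier–Stokes
system with viscosity `ν_j` (as time-independent classical solutions on `ℝ × T³`); `∫‖U_j‖² ≤ E`;
`ν_j ‖∇U_j‖₂² ≥ ε > 0`.  Then the zeroth law holds (take `u_j(t) := U_j`, `u₀ := U_j`; the
running means of a constant are the constant, `longTimeAvgSup_of_eq_const`). [folklore] -/
theorem anomalousDissipation_of_steadyFamily {f : 𝕋³ → E³} (hf : Torus.IsSmooth f)
    (hdiv : Torus.IsDivFree f) (hmean : Torus.HasZeroMean f)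
    {ν : ℕ → ℝ} {U : ℕ → 𝕋³ → E³} {P : ℕ → 𝕋³ → ℝ}
    (hν : ∀ j, 0 < ν j) (hν0 : Tendsto ν atTop (𝓝 0))
    (hsol : ∀ j, Torus.IsClassicalNSSolutionOn univ (ν j) (fun _ => f) (fun _ => U j) (fun _ => P j))
    (hE : ∃ E : ℝ, ∀ j, ∫ x, ‖U j x‖ ^ 2 ≤ E)
    (hε : ∃ ε : ℝ, 0 < ε ∧ ∀ j, ε ≤ ν j * Torus.gradNormSq (U j)) :
    _root_.AnomalousDissipation := by
  obtain ⟨E, hE⟩ := hE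
  obtain ⟨ε, hε, hεle⟩ := hε
  refine anomalousDissipation_of_classicalFamily hf hdiv hmean hν hν0 hsol ⟨E, fun j => ?_⟩
    ⟨ε, hε, fun j => ?_⟩
  · rw [meanEnergy_eq_longTimeAvgSup, longTimeAvgSup_of_eq_const fun t _ => rfl]
    exact hE j
  · rw [longTimeAvgSup_of_eq_const fun t _ => rfl]
    exact hεle j

end Summit.AnomalousDissipation.AnomalousDissipation.Theorems

end
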